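import Mathlib.MeasureTheory.Constructions.HaarToSphere
import Mathlib.Analysis.SpecialFunctions.Pow.Integral
import Mathlib.Analysis.SpecialFunctions.ImproperIntegrals
import Mathlib.MeasureTheory.Integral.MeanInequalities
import Literature.Analysis.FluidPDE.NewtonPotential
import HarnessLib

/-!
# Hölder continuity of potentials of `L^p` densities against singular kernels on `ℝ³`

Analysis/FluidPDE support file (everything proved) on the discharge path of the named fact
`Literature.Analysis.FluidPDE.LaplaceDivFormInteriorHolder` (`NSBoundedSpatialHolder.lean`;
Gilbarg–Trudinger 2001, Thm. 8.24 for the Laplacian: interior Hölder continuity of `W^{1,2}`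
weak solutions of `Δw = ∂ⱼFⱼ`, `F ∈ L^q`, `q > 3`). The planned discharge is
potential-theoretic: after localisation, `χw = ∑ⱼ (∂ⱼΓ) ⋆ fⱼ + Γ ⋆ h` up to a function weakly
harmonic on a smaller ball, with `f ∈ L^q`, `h ∈ L²` compactly supported and `Γ = -1/(4π|z|)`
the Newtonian kernel of the tree (`FluidPDE/NewtonKernel`). This file supplies the Hölder and
sup-norm estimates for such potentials, in the generality of a **singular kernel of degree
`-a`** (`IsSingularKernel k a A B`: `|k(z)| ≤ A|z|^{-a}` and
`|k(x - y) - k(z - y)| ≤ B|x - z||x - y|^{-(a+1)}` for `|x - y| ≥ 2|x - z|`):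

* radial power integrals in `ℝ³` (`integral_ball_norm_rpow_neg`:
  `∫_{B_r} |z|^{-s} = 3|B₁| r^{3-s}/(3-s)`, `s < 3`; `integral_compl_ball_norm_rpow_neg`:
  `∫_{|z| ≥ r} |z|^{-t} = 3|B₁| r^{3-t}/(t-3)`, `t > 3`; polar coordinates through Mathlib's
  `integral_fun_norm_addHaar`), their `ℝ≥0∞` forms and translation invariance;
* the near-field size bound `∫_{B(w,R)} |k(w - y)|^q ≤ A^q 3|B₁| R^{3-aq}/(3-aq)`
  (`lintegral_ball_enorm_kernel_rpow_le`) and the far-field regularity bound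
  `∫_{|x-y| ≥ 2d} |k(x-y) - k(z-y)|^q ≤ (Bd)^q 3|B₁| (2d)^{3-(a+1)q}/((a+1)q-3)`, `d = |x - z|`
  (`lintegral_compl_ball_enorm_kernel_sub_rpow_le`);
* for conjugate exponents `p, q` with `aq < 3 < (a+1)q` and `f ∈ L^p` vanishing off a ball:
  convergence of the potential `P f(x) = ∫ f(y) k(x - y) dy` (`integrable_mul_kernel`), the
  sup bound `|P f(x)| ≤ A (3|B₁|/(3-aq))^{1/q} (2ρ)^{3/q-a} ‖f‖_p` on `B̄(c, ρ) ⊇ supp f`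
  (`abs_potential_le`) and the **Hölder estimate**
  `|P f(x) - P f(z)| ≤ C ‖f‖_p |x - z|^{3/q - a}` with an explicit `C = C(a, A, B, q)`
  (`abs_potential_sub_le`; proof: split at `|x - y| = 2|x - z|`, Hölder's inequality on both
  pieces — Majda–Bertozzi 2002, proof of Lemma 8.1, and Gilbarg–Trudinger 2001, Lemma 7.12, are
  the models);
* the instances: `Γ` is a singular kernel of degree `-1` with `A = (4π)⁻¹`, `B = π⁻¹`
  (`isSingularKernel_newtonKernel`) and `∂ⱼΓ(z) = zⱼ/(4π|z|³)` (`newtonKernelGrad j`, equal to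
  `DΓ(z)eⱼ` off the origin) one of degree `-2` with `A = (4π)⁻¹`, `B = 8/π`
  (`isSingularKernel_newtonKernelGrad`), by the mean value inequality on the segment
  `[x - y, z - y]` (all of whose points have norm `≥ |x - y|/2`) with the tree's bounds
  `|DΓ(w)| = (4π|w|²)⁻¹`, `|D²Γ(w)(a,b)| ≤ |a||b|/(π|w|³)`.

Consequently `Γ ⋆ h`, `h ∈ L²` (`a = 1`, `p = q = 2`), is `C^{0,1/2}` and `(∂ⱼΓ) ⋆ f`,
`f ∈ L^{q}`, `q > 3` (`a = 2`, kernel exponent `q' = q/(q-1) < 3/2`), is `C^{0,1-3/q}`.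

## Mathlib / tree search

Mathlib: `integral_fun_norm_addHaar`, `integrableOn_ball_of_norm_le_rpow`, `integral_rpow`,
`integral_Ioi_rpow_of_lt`, `ENNReal.lintegral_mul_le_Lp_mul_Lq` (Hölder),
`lintegral_add_compl`, `lintegral_sub_left_eq_self`,
`Convex.norm_image_sub_le_of_norm_fderiv_le` (all used); no Riesz-potential or
Hardy–Littlewood–Sobolev estimates (`lean search 'riesz|Riesz potential|fractional integral'`:
nothing relevant). Tree: `newtonKernel` with `abs_newtonKernel`, `norm_fderiv_newtonKernel`,
`fderiv_newtonKernel_apply`, `abs_fderiv_fderiv_newtonKernel_apply_le`, `contDiffAt_newtonKernel`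
(`NewtonKernel`), `measurable_newtonKernel` (`NewtonPotential`).

## References

* D. Gilbarg, N. S. Trudinger, *Elliptic Partial Differential Equations of Second Order*
  (2001), §4.1 (2.12)–(2.14) (the Newtonian kernel), Lemma 4.1, Lemma 7.12 (potential
  estimates). [`GilbargTrudinger2001`]
* A. J. Majda, A. L. Bertozzi, *Vorticity and Incompressible Flow* (2002), Lemma 8.1 and its
  proof (split at `2d`, quasi-Lipschitz estimate for the Biot–Savart kernel).
  [`MajdaBertozziCUP2002`]
-/

noncomputable section

open MeasureTheory Set Function Filter Topology TopologicalSpace Metric Real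
open scoped NNReal ENNReal RealInnerProductSpace

namespace Literature.Analysis.FluidPDE

/-- Local notation for physical space `ℝ³ = EuclideanSpace ℝ (Fin 3)`. -/
local notation "ℝ³" => EuclideanSpace ℝ (Fin 3)

/-- Local notation for the standard basis vectors of `ℝ³`. -/
local notation "𝐞" j => EuclideanSpace.single (j : Fin 3) (1 : ℝ)

namespace NewtonPotentialHolder

/-- **Radial power integral on a ball**: `∫_{B(0,r)} |z|^{-s} dz = 3|B₁| r^{3-s}/(3-s)` for
`s < 3`, `r > 0` (polar coordinates, `integral_fun_norm_addHaar`). [folklore] -/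
theorem integral_ball_norm_rpow_neg {s r : ℝ} (hs : s < 3) (hr : 0 < r) :
    ∫ z in ball (0 : ℝ³) r, ‖z‖ ^ (-s) =
      3 * (volume : Measure ℝ³).real (ball 0 1) * (r ^ (3 - s) / (3 - s)) := by
  set F : ℝ → ℝ := (Iio r).indicator fun y => y ^ (-s) with hF
  have h1 : ∫ z in ball (0 : ℝ³) r, ‖z‖ ^ (-s) = ∫ z : ℝ³, F ‖z‖ := by
    rw [← integral_indicator measurableSet_ball]
    congr 1
    funext z
    by_cases hz : z ∈ ball (0 : ℝ³) r
    · have : ‖z‖ ∈ Iio r := by simpa using hz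
      rw [indicator_of_mem hz, hF, indicator_of_mem this]
    · have : ‖z‖ ∉ Iio r := by simpa using hz
      rw [indicator_of_notMem hz, hF, indicator_of_notMem this]
  rw [h1, integral_fun_norm_addHaar, finrank_euclideanSpace_fin]
  have h2 : ∫ y in Ioi (0 : ℝ), y ^ (3 - 1) • F y = ∫ y in Ioo 0 r, y ^ (2 - s) := by
    have e : (fun y : ℝ => y ^ (3 - 1) • F y) =
        (Iio r).indicator fun y => y ^ (2 : ℕ) * y ^ (-s) := by
      funext y
      rw [hF]
      by_cases hy : y ∈ Iio r
      · simp [indicator_of_mem hy]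
      · simp [indicator_of_notMem hy]
    rw [e, setIntegral_indicator measurableSet_Iio, Ioi_inter_Iio]
    refine setIntegral_congr_fun measurableSet_Ioo fun y hy => ?_
    rw [← Real.rpow_natCast, ← Real.rpow_add hy.1]
    norm_num
    rw [sub_eq_add_neg]
  rw [h2]
  have h3 : ∫ y in Ioo 0 r, y ^ (2 - s) = r ^ (3 - s) / (3 - s) := by
    rw [← integral_Ioc_eq_integral_Ioo, ← intervalIntegral.integral_of_le hr.le,
      integral_rpow (Or.inl (by linarith : (-1 : ℝ) < 2 - s)),
      Real.zero_rpow (by linarith : (2 - s + 1 : ℝ) ≠ 0)]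
    ring_nf
  rw [h3]
  simp [smul_eq_mul]
  ring

/-- **Radial power integral off a ball**: `∫_{|z| ≥ r} |z|^{-t} dz = 3|B₁| r^{3-t}/(t-3)` for
`t > 3`, `r > 0`. [folklore] -/
theorem integral_compl_ball_norm_rpow_neg {t r : ℝ} (ht : 3 < t) (hr : 0 < r) :
    ∫ z in (ball (0 : ℝ³) r)ᶜ, ‖z‖ ^ (-t) =
      3 * (volume : Measure ℝ³).real (ball 0 1) * (r ^ (3 - t) / (t - 3)) := by
  set F : ℝ → ℝ := (Ici r).indicator fun y => y ^ (-t) with hF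
  have h1 : ∫ z in (ball (0 : ℝ³) r)ᶜ, ‖z‖ ^ (-t) = ∫ z : ℝ³, F ‖z‖ := by
    rw [← integral_indicator measurableSet_ball.compl]
    congr 1
    funext z
    by_cases hz : z ∈ (ball (0 : ℝ³) r)ᶜ
    · have : ‖z‖ ∈ Ici r := by simpa using hz
      rw [indicator_of_mem hz, hF, indicator_of_mem this]
    · have : ‖z‖ ∉ Ici r := by simpa using hz
      rw [indicator_of_notMem hz, hF, indicator_of_notMem this]
  rw [h1, integral_fun_norm_addHaar, finrank_euclideanSpace_fin]
  have h2 : ∫ y in Ioi (0 : ℝ), y ^ (3 - 1) • F y = ∫ y in Ioi r, y ^ (2 - t) := by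
    have e : (fun y : ℝ => y ^ (3 - 1) • F y) =
        (Ici r).indicator fun y => y ^ (2 : ℕ) * y ^ (-t) := by
      funext y
      rw [hF]
      by_cases hy : y ∈ Ici r
      · simp [indicator_of_mem hy]
      · simp [indicator_of_notMem hy]
    have hI : Ioi (0 : ℝ) ∩ Ici r = Ici r :=
      inter_eq_right.2 fun y hy => lt_of_lt_of_le hr hy
    rw [e, setIntegral_indicator measurableSet_Ici, hI, integral_Ici_eq_integral_Ioi]
    refine setIntegral_congr_fun measurableSet_Ioi fun y hy => ?_
    have hy0 : 0 < y := hr.trans hy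
    rw [← Real.rpow_natCast, ← Real.rpow_add hy0]
    norm_num
    rw [sub_eq_add_neg]
  rw [h2, integral_Ioi_rpow_of_lt (by linarith : (2 - t : ℝ) < -1) hr]
  simp only [smul_eq_mul]
  have h3 : (2 - t + 1 : ℝ) = 3 - t := by ring
  have h6 : r ^ (3 - t) / (t - 3) = -r ^ (3 - t) / (3 - t) := by
    rw [← neg_div_neg_eq, neg_sub]
  rw [h3, h6]
  ring

/-- `|z|^{-s}` is integrable on balls about the origin for `s < 3`. [folklore] -/
theorem integrableOn_ball_norm_rpow_neg {s : ℝ} (hs : s < 3) (r : ℝ) :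
    IntegrableOn (fun z : ℝ³ => ‖z‖ ^ (-s)) (ball 0 r) volume := by
  refine integrableOn_ball_of_norm_le_rpow (by rw [finrank_euclideanSpace_fin]; norm_num) (C := 1) (α := s)
    (by rw [finrank_euclideanSpace_fin]; exact_mod_cast hs) (Eventually.of_forall fun z => ?_) ?_
  · rw [Real.norm_of_nonneg (Real.rpow_nonneg (norm_nonneg _) _), one_mul]
  · exact (continuous_norm.measurable.pow_const _).aestronglyMeasurable

/-- `|z|^{-t}` is integrable off balls about the origin for `t > 3`. [folklore] -/
theorem integrableOn_compl_ball_norm_rpow_neg {t r : ℝ} (ht : 3 < t) (hr : 0 < r) :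
    IntegrableOn (fun z : ℝ³ => ‖z‖ ^ (-t)) (ball 0 r)ᶜ volume := by
  set F : ℝ → ℝ := (Ici r).indicator fun y => y ^ (-t) with hF
  have hFi : Integrable (fun z : ℝ³ => F ‖z‖) volume := by
    rw [integrable_fun_norm_addHaar, finrank_euclideanSpace_fin]
    have e : (fun y : ℝ => y ^ (3 - 1) • F y) =
        (Ici r).indicator fun y => y ^ (2 : ℕ) * y ^ (-t) := by
      funext y
      rw [hF]
      by_cases hy : y ∈ Ici r
      · simp [indicator_of_mem hy]
      · simp [indicator_of_notMem hy]
    rw [e, IntegrableOn, integrable_indicator_iff measurableSet_Ici]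
    have hI : IntegrableOn (fun y : ℝ => y ^ (2 - t)) (Ici r) volume := by
      rw [integrableOn_Ici_iff_integrableOn_Ioi]
      exact integrableOn_Ioi_rpow_of_lt (by linarith) hr
    have hI' : IntegrableOn (fun y : ℝ => y ^ (2 - t)) (Ici r) (volume.restrict (Ioi 0)) :=
      hI.mono_measure Measure.restrict_le_self
    refine hI'.congr_fun (fun y hy => ?_) measurableSet_Ici
    have hy0 : 0 < y := hr.trans_le hy
    rw [← Real.rpow_natCast, ← Real.rpow_add hy0]
    norm_num
    rw [sub_eq_add_neg]
  have heq : (fun z : ℝ³ => F ‖z‖) = (ball (0 : ℝ³) r)ᶜ.indicator fun z => ‖z‖ ^ (-t) := by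
    funext z
    by_cases hz : z ∈ (ball (0 : ℝ³) r)ᶜ
    · have : ‖z‖ ∈ Ici r := by simpa using hz
      rw [indicator_of_mem hz, hF, indicator_of_mem this]
    · have : ‖z‖ ∉ Ici r := by simpa using hz
      rw [indicator_of_notMem hz, hF, indicator_of_notMem this]
  rw [heq, integrable_indicator_iff measurableSet_ball.compl] at hFi
  exact hFi

/-- `ℝ≥0∞` form of `integral_ball_norm_rpow_neg`. [folklore] -/
theorem lintegral_ball_norm_rpow_neg {s r : ℝ} (hs : s < 3) (hr : 0 < r) :
    ∫⁻ z in ball (0 : ℝ³) r, ENNReal.ofReal (‖z‖ ^ (-s)) =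
      ENNReal.ofReal (3 * (volume : Measure ℝ³).real (ball 0 1) * (r ^ (3 - s) / (3 - s))) := by
  rw [← integral_ball_norm_rpow_neg hs hr, ofReal_integral_eq_lintegral_ofReal
    (integrableOn_ball_norm_rpow_neg hs r) (Eventually.of_forall fun z => by positivity)]

/-- `ℝ≥0∞` form of `integral_compl_ball_norm_rpow_neg`. [folklore] -/
theorem lintegral_compl_ball_norm_rpow_neg {t r : ℝ} (ht : 3 < t) (hr : 0 < r) :
    ∫⁻ z in (ball (0 : ℝ³) r)ᶜ, ENNReal.ofReal (‖z‖ ^ (-t)) =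
      ENNReal.ofReal (3 * (volume : Measure ℝ³).real (ball 0 1) * (r ^ (3 - t) / (t - 3))) := by
  rw [← integral_compl_ball_norm_rpow_neg ht hr, ofReal_integral_eq_lintegral_ofReal
    (integrableOn_compl_ball_norm_rpow_neg ht hr) (Eventually.of_forall fun z => by positivity)]

/-- Translation: `∫⁻_{B(x,r)} g(x - y) dy = ∫⁻_{B(0,r)} g(z) dz`. [folklore] -/
theorem lintegral_ball_comp_sub_left (g : ℝ³ → ℝ≥0∞) (x : ℝ³) (r : ℝ) :
    ∫⁻ y in ball x r, g (x - y) = ∫⁻ z in ball (0 : ℝ³) r, g z := by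
  rw [← lintegral_indicator measurableSet_ball, ← lintegral_indicator measurableSet_ball,
    ← lintegral_sub_left_eq_self (fun z => (ball (0 : ℝ³) r).indicator g z) x]
  congr 1
  funext y
  by_cases hy : y ∈ ball x r
  · have : x - y ∈ ball (0 : ℝ³) r := by
      rw [mem_ball_zero_iff, ← dist_eq_norm, dist_comm]; exact hy
    rw [indicator_of_mem hy, indicator_of_mem this]
  · have : x - y ∉ ball (0 : ℝ³) r := by
      rw [mem_ball_zero_iff, ← dist_eq_norm, dist_comm]; exact hy
    rw [indicator_of_notMem hy, indicator_of_notMem this]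

/-- Translation: `∫⁻_{B(x,r)ᶜ} g(x - y) dy = ∫⁻_{B(0,r)ᶜ} g(z) dz`. [folklore] -/
theorem lintegral_compl_ball_comp_sub_left (g : ℝ³ → ℝ≥0∞) (x : ℝ³) (r : ℝ) :
    ∫⁻ y in (ball x r)ᶜ, g (x - y) = ∫⁻ z in (ball (0 : ℝ³) r)ᶜ, g z := by
  rw [← lintegral_indicator measurableSet_ball.compl,
    ← lintegral_indicator measurableSet_ball.compl,
    ← lintegral_sub_left_eq_self (fun z => (ball (0 : ℝ³) r)ᶜ.indicator g z) x]
  congr 1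
  funext y
  by_cases hy : y ∈ (ball x r)ᶜ
  · have : x - y ∈ (ball (0 : ℝ³) r)ᶜ := by
      rw [mem_compl_iff, mem_ball_zero_iff, ← dist_eq_norm, dist_comm]; exact hy
    rw [indicator_of_mem hy, indicator_of_mem this]
  · have : x - y ∉ (ball (0 : ℝ³) r)ᶜ := by
      rw [mem_compl_iff, mem_ball_zero_iff, ← dist_eq_norm, dist_comm]; exact hy
    rw [indicator_of_notMem hy, indicator_of_notMem this]

/-! ### Kernels with the size and regularity of a homogeneous kernel of degree `-a` -/

/-- A measurable kernel `k` on `ℝ³` with `|k(z)| ≤ A|z|^{-a}` and the Hörmander-type regularity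
`|k(x - y) - k(z - y)| ≤ B|x - z| |x - y|^{-(a+1)}` for `|x - y| ≥ 2|x - z|` (as satisfied by a
kernel homogeneous of degree `-a` which is `C¹` off the origin with `|∇k(w)| ≲ |w|^{-a-1}`; e.g.
`Γ` with `a = 1` and `∂ⱼΓ` with `a = 2`). [folklore] -/
structure IsSingularKernel (k : ℝ³ → ℝ) (a A B : ℝ) : Prop where
  measurable : Measurable k
  abs_le : ∀ z, |k z| ≤ A * ‖z‖ ^ (-a)
  abs_sub_le : ∀ x z y, x ≠ z → 2 * ‖x - z‖ ≤ ‖x - y‖ →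
    |k (x - y) - k (z - y)| ≤ B * ‖x - z‖ * ‖x - y‖ ^ (-(a + 1))

variable {k : ℝ³ → ℝ} {a A B : ℝ}

/-- **Near-field size bound**: `∫_{B(w,R')} |k(w - y)|^q dy ≤ A^q · 3|B₁| R'^{3-aq}/(3-aq)` for
`aq < 3`. [folklore] -/
theorem lintegral_ball_enorm_kernel_rpow_le (hk : IsSingularKernel k a A B) (hA : 0 ≤ A)
    {q : ℝ} (hq : 0 < q) (haq : a * q < 3) (w : ℝ³) {R' : ℝ} (hR' : 0 < R') :
    ∫⁻ y in ball w R', ‖k (w - y)‖ₑ ^ q ≤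
      ENNReal.ofReal (A ^ q * (3 * (volume : Measure ℝ³).real (ball 0 1) *
        (R' ^ (3 - a * q) / (3 - a * q)))) := by
  have hpt : ∀ y, ‖k (w - y)‖ₑ ^ q ≤
      ENNReal.ofReal (A ^ q) * ENNReal.ofReal (‖w - y‖ ^ (-(a * q))) := by
    intro y
    rw [← ENNReal.ofReal_mul (by positivity), ← ofReal_norm, Real.norm_eq_abs,
      ENNReal.ofReal_rpow_of_nonneg (abs_nonneg _) hq.le]
    refine ENNReal.ofReal_le_ofReal ?_
    calc |k (w - y)| ^ q ≤ (A * ‖w - y‖ ^ (-a)) ^ q :=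
          Real.rpow_le_rpow (abs_nonneg _) (hk.abs_le _) hq.le
      _ = A ^ q * ‖w - y‖ ^ (-(a * q)) := by
          rw [Real.mul_rpow hA (Real.rpow_nonneg (norm_nonneg _) _),
            ← Real.rpow_mul (norm_nonneg _), neg_mul]
  calc ∫⁻ y in ball w R', ‖k (w - y)‖ₑ ^ q
      ≤ ∫⁻ y in ball w R', ENNReal.ofReal (A ^ q) * ENNReal.ofReal (‖w - y‖ ^ (-(a * q))) :=
        lintegral_mono fun y => hpt y
    _ = ENNReal.ofReal (A ^ q) * ∫⁻ y in ball w R', ENNReal.ofReal (‖w - y‖ ^ (-(a * q))) := by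
        rw [lintegral_const_mul' _ _ ENNReal.ofReal_ne_top]
    _ = ENNReal.ofReal (A ^ q) * ∫⁻ z in ball (0 : ℝ³) R', ENNReal.ofReal (‖z‖ ^ (-(a * q))) := by
        rw [lintegral_ball_comp_sub_left (fun z => ENNReal.ofReal (‖z‖ ^ (-(a * q)))) w R']
    _ = ENNReal.ofReal (A ^ q * (3 * (volume : Measure ℝ³).real (ball 0 1) *
        (R' ^ (3 - a * q) / (3 - a * q)))) := by
        rw [lintegral_ball_norm_rpow_neg haq hR', ← ENNReal.ofReal_mul (by positivity)]

/-- **Far-field regularity bound**: for `x ≠ z`, `d = |x - z|`,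
`∫_{|x-y| ≥ 2d} |k(x - y) - k(z - y)|^q dy ≤ (Bd)^q · 3|B₁| (2d)^{3-(a+1)q}/((a+1)q-3)` for
`(a+1)q > 3`. [folklore] -/
theorem lintegral_compl_ball_enorm_kernel_sub_rpow_le (hk : IsSingularKernel k a A B) (hB : 0 ≤ B)
    {q : ℝ} (hq : 0 < q) (haq : 3 < (a + 1) * q) {x z : ℝ³} (hxz : x ≠ z) :
    ∫⁻ y in (ball x (2 * ‖x - z‖))ᶜ, ‖k (x - y) - k (z - y)‖ₑ ^ q ≤
      ENNReal.ofReal ((B * ‖x - z‖) ^ q * (3 * (volume : Measure ℝ³).real (ball 0 1) *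
        ((2 * ‖x - z‖) ^ (3 - (a + 1) * q) / ((a + 1) * q - 3)))) := by
  have hd : 0 < ‖x - z‖ := norm_pos_iff.2 (sub_ne_zero.2 hxz)
  have hpt : ∀ y ∈ (ball x (2 * ‖x - z‖))ᶜ, ‖k (x - y) - k (z - y)‖ₑ ^ q ≤
      ENNReal.ofReal ((B * ‖x - z‖) ^ q) * ENNReal.ofReal (‖x - y‖ ^ (-((a + 1) * q))) := by
    intro y hy
    have hy' : 2 * ‖x - z‖ ≤ ‖x - y‖ := by
      rw [mem_compl_iff, mem_ball, not_lt, dist_eq_norm, norm_sub_rev y x] at hy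
      exact hy
    rw [← ENNReal.ofReal_mul (by positivity), ← ofReal_norm, Real.norm_eq_abs,
      ENNReal.ofReal_rpow_of_nonneg (abs_nonneg _) hq.le]
    refine ENNReal.ofReal_le_ofReal ?_
    calc |k (x - y) - k (z - y)| ^ q ≤ (B * ‖x - z‖ * ‖x - y‖ ^ (-(a + 1))) ^ q :=
          Real.rpow_le_rpow (abs_nonneg _) (hk.abs_sub_le x z y hxz hy') hq.le
      _ = (B * ‖x - z‖) ^ q * ‖x - y‖ ^ (-((a + 1) * q)) := by
          rw [Real.mul_rpow (by positivity) (Real.rpow_nonneg (norm_nonneg _) _),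
            ← Real.rpow_mul (norm_nonneg _), neg_mul]
  calc ∫⁻ y in (ball x (2 * ‖x - z‖))ᶜ, ‖k (x - y) - k (z - y)‖ₑ ^ q
      ≤ ∫⁻ y in (ball x (2 * ‖x - z‖))ᶜ, ENNReal.ofReal ((B * ‖x - z‖) ^ q) *
          ENNReal.ofReal (‖x - y‖ ^ (-((a + 1) * q))) :=
        setLIntegral_mono' measurableSet_ball.compl fun y hy => hpt y hy
    _ = ENNReal.ofReal ((B * ‖x - z‖) ^ q) *
          ∫⁻ y in (ball x (2 * ‖x - z‖))ᶜ, ENNReal.ofReal (‖x - y‖ ^ (-((a + 1) * q))) := by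
        rw [lintegral_const_mul' _ _ ENNReal.ofReal_ne_top]
    _ = ENNReal.ofReal ((B * ‖x - z‖) ^ q) *
          ∫⁻ w in (ball (0 : ℝ³) (2 * ‖x - z‖))ᶜ, ENNReal.ofReal (‖w‖ ^ (-((a + 1) * q))) := by
        rw [lintegral_compl_ball_comp_sub_left
          (fun w => ENNReal.ofReal (‖w‖ ^ (-((a + 1) * q)))) x (2 * ‖x - z‖)]
    _ = ENNReal.ofReal ((B * ‖x - z‖) ^ q * (3 * (volume : Measure ℝ³).real (ball 0 1) *
        ((2 * ‖x - z‖) ^ (3 - (a + 1) * q) / ((a + 1) * q - 3)))) := by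
        rw [lintegral_compl_ball_norm_rpow_neg haq (by positivity),
          ← ENNReal.ofReal_mul (by positivity)]

/-! ### The Hölder estimate for the potential `P f (x) = ∫ f(y) k(x - y) dy` -/

/-- The volume constant `3|B₁|` of the radial integrals. [folklore] -/
theorem three_mul_volume_real_ball_nonneg : 0 ≤ 3 * (volume : Measure ℝ³).real (ball 0 1) := by
  positivity

/-- **Raw form of the Hölder estimate.** For a singular kernel of degree `-a`, conjugate
exponents `p, q` with `aq < 3 < (a+1)q`, a measurable density `f` and points `x ≠ z` at which
the potential integrals converge, `|P f(x) - P f(z)| ≤ ‖f‖_p (N₁(2d)^{1/q} + N₁(3d)^{1/q} +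
N₂(d)^{1/q})`, `d = |x - z|`, with the near-field bounds `N₁` of
`lintegral_ball_enorm_kernel_rpow_le` and the far-field bound `N₂` of
`lintegral_compl_ball_enorm_kernel_sub_rpow_le` (split the integral at `|x - y| = 2d` and use
Hölder's inequality on each piece). [folklore] -/
theorem enorm_potential_sub_le_raw (hk : IsSingularKernel k a A B) (hA : 0 ≤ A) (hB : 0 ≤ B)
    {p q : ℝ} (hpq : p.HolderConjugate q) (haq : a * q < 3) (haq' : 3 < (a + 1) * q)
    {f : ℝ³ → ℝ} (hf : AEStronglyMeasurable f volume) {x z : ℝ³} (hxz : x ≠ z)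
    (hfx : Integrable (fun y => f y * k (x - y)) volume)
    (hfz : Integrable (fun y => f y * k (z - y)) volume) :
    ‖(∫ y, f y * k (x - y)) - ∫ y, f y * k (z - y)‖ₑ ≤
      (∫⁻ y, ‖f y‖ₑ ^ p) ^ (1 / p) *
        ((ENNReal.ofReal (A ^ q * (3 * (volume : Measure ℝ³).real (ball 0 1) *
            ((2 * ‖x - z‖) ^ (3 - a * q) / (3 - a * q))))) ^ (1 / q) +
         (ENNReal.ofReal (A ^ q * (3 * (volume : Measure ℝ³).real (ball 0 1) *
            ((3 * ‖x - z‖) ^ (3 - a * q) / (3 - a * q))))) ^ (1 / q) +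
         (ENNReal.ofReal ((B * ‖x - z‖) ^ q * (3 * (volume : Measure ℝ³).real (ball 0 1) *
            ((2 * ‖x - z‖) ^ (3 - (a + 1) * q) / ((a + 1) * q - 3))))) ^ (1 / q)) := by
  have hq : 0 < q := hpq.symm.pos
  have hp : 0 < p := hpq.pos
  have hd : 0 < ‖x - z‖ := norm_pos_iff.2 (sub_ne_zero.2 hxz)
  set d : ℝ := ‖x - z‖ with hdd
  set S : Set ℝ³ := ball x (2 * d) with hS
  have hSm : MeasurableSet S := measurableSet_ball
  -- measurability
  have hkm : ∀ w : ℝ³, Measurable fun y => k (w - y) := fun w =>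
    hk.measurable.comp (measurable_const.sub measurable_id)
  have hfm : AEMeasurable (fun y => ‖f y‖ₑ) volume := hf.aemeasurable.enorm
  set Nf : ℝ≥0∞ := (∫⁻ y, ‖f y‖ₑ ^ p) ^ (1 / p) with hNf
  -- Hölder on a set, with the `f`-factor extended to the whole space
  have holder : ∀ (T : Set ℝ³) (g : ℝ³ → ℝ≥0∞), AEMeasurable g (volume.restrict T) →
      ∫⁻ y in T, ‖f y‖ₑ * g y ≤ Nf * (∫⁻ y in T, g y ^ q) ^ (1 / q) := by
    intro T g hg
    have h := ENNReal.lintegral_mul_le_Lp_mul_Lq (volume.restrict T) hpq hfm.restrict hg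
    refine h.trans ?_
    gcongr
    rw [hNf]
    exact ENNReal.rpow_le_rpow (lintegral_mono' Measure.restrict_le_self le_rfl) (by positivity)
  -- the difference of the potentials as one integral
  have hdiff : (∫ y, f y * k (x - y)) - ∫ y, f y * k (z - y) =
      ∫ y, f y * (k (x - y) - k (z - y)) := by
    rw [← integral_sub hfx hfz]
    refine integral_congr_ae (Eventually.of_forall fun y => ?_)
    ring
  rw [hdiff]
  refine (enorm_integral_le_lintegral_enorm _).trans ?_
  have hsplit := lintegral_add_compl (μ := (volume : Measure ℝ³))
    (fun y => ‖f y * (k (x - y) - k (z - y))‖ₑ) hSm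
  rw [← hsplit]
  simp_rw [enorm_mul]
  -- near field
  have hnear : ∫⁻ y in S, ‖f y‖ₑ * ‖k (x - y) - k (z - y)‖ₑ ≤
      Nf * ((ENNReal.ofReal (A ^ q * (3 * (volume : Measure ℝ³).real (ball 0 1) *
            ((2 * d) ^ (3 - a * q) / (3 - a * q))))) ^ (1 / q) +
         (ENNReal.ofReal (A ^ q * (3 * (volume : Measure ℝ³).real (ball 0 1) *
            ((3 * d) ^ (3 - a * q) / (3 - a * q))))) ^ (1 / q)) := by
    have hmeas : AEMeasurable (fun y => ‖f y‖ₑ * ‖k (x - y)‖ₑ) (volume.restrict S) :=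
      hfm.restrict.mul (hkm x).enorm.aemeasurable
    have h1 : ∫⁻ y in S, ‖f y‖ₑ * ‖k (x - y) - k (z - y)‖ₑ ≤
        (∫⁻ y in S, ‖f y‖ₑ * ‖k (x - y)‖ₑ) + ∫⁻ y in S, ‖f y‖ₑ * ‖k (z - y)‖ₑ := by
      rw [← lintegral_add_left' hmeas]
      refine lintegral_mono fun y => ?_
      rw [← mul_add]
      gcongr
      exact enorm_sub_le
    refine h1.trans ?_
    rw [mul_add]
    refine add_le_add ?_ ?_
    · refine (holder S _ (hkm x).enorm.aemeasurable).trans ?_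
      gcongr
      exact lintegral_ball_enorm_kernel_rpow_le hk hA hq haq x (by positivity)
    · refine (holder S _ (hkm z).enorm.aemeasurable).trans ?_
      gcongr Nf * ?_
      refine ENNReal.rpow_le_rpow ?_ (by positivity)
      have hsub : S ⊆ ball z (3 * d) := by
        intro y hy
        rw [hS, mem_ball] at hy
        rw [mem_ball]
        have hxz' : dist x z = d := by rw [hdd, dist_eq_norm]
        calc dist y z ≤ dist y x + dist x z := dist_triangle _ _ _
          _ < 2 * d + d := by linarith
          _ = 3 * d := by ring
      exact (lintegral_mono_set hsub).trans
        (lintegral_ball_enorm_kernel_rpow_le hk hA hq haq z (by positivity))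
  -- far field
  have hfar : ∫⁻ y in Sᶜ, ‖f y‖ₑ * ‖k (x - y) - k (z - y)‖ₑ ≤
      Nf * (ENNReal.ofReal ((B * d) ^ q * (3 * (volume : Measure ℝ³).real (ball 0 1) *
            ((2 * d) ^ (3 - (a + 1) * q) / ((a + 1) * q - 3))))) ^ (1 / q) := by
    have hm : AEMeasurable (fun y => ‖k (x - y) - k (z - y)‖ₑ) (volume.restrict Sᶜ) :=
      ((hkm x).sub (hkm z)).enorm.aemeasurable
    refine (holder Sᶜ _ hm).trans ?_
    gcongr
    exact lintegral_compl_ball_enorm_kernel_sub_rpow_le hk hB hq haq' hxz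
  calc (∫⁻ y in S, ‖f y‖ₑ * ‖k (x - y) - k (z - y)‖ₑ) +
      ∫⁻ y in Sᶜ, ‖f y‖ₑ * ‖k (x - y) - k (z - y)‖ₑ
      ≤ _ := add_le_add hnear hfar
    _ = _ := by ring

/-- **Size bound for the potential integrand**: if `f` vanishes off `B(x, R')` then
`∫ |f(y)| |k(x - y)| dy ≤ ‖f‖_p (A^q 3|B₁| R'^{3-aq}/(3-aq))^{1/q}` (Hölder). [folklore] -/
theorem lintegral_enorm_mul_kernel_le (hk : IsSingularKernel k a A B) (hA : 0 ≤ A)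
    {p q : ℝ} (hpq : p.HolderConjugate q) (haq : a * q < 3)
    {f : ℝ³ → ℝ} (hf : AEStronglyMeasurable f volume) {x : ℝ³} {R' : ℝ} (hR' : 0 < R')
    (hsupp : support f ⊆ ball x R') :
    ∫⁻ y, ‖f y‖ₑ * ‖k (x - y)‖ₑ ≤
      (∫⁻ y, ‖f y‖ₑ ^ p) ^ (1 / p) *
        (ENNReal.ofReal (A ^ q * (3 * (volume : Measure ℝ³).real (ball 0 1) *
          (R' ^ (3 - a * q) / (3 - a * q))))) ^ (1 / q) := by
  have hq : 0 < q := hpq.symm.pos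
  have hp : 0 < p := hpq.pos
  have hkm : Measurable fun y => k (x - y) :=
    hk.measurable.comp (measurable_const.sub measurable_id)
  have hfm : AEMeasurable (fun y => ‖f y‖ₑ) volume := hf.aemeasurable.enorm
  -- the integrand vanishes off the ball
  have hT : ∫⁻ y, ‖f y‖ₑ * ‖k (x - y)‖ₑ = ∫⁻ y in ball x R', ‖f y‖ₑ * ‖k (x - y)‖ₑ := by
    rw [← lintegral_indicator measurableSet_ball]
    refine lintegral_congr fun y => ?_
    by_cases hy : y ∈ ball x R'
    · rw [indicator_of_mem hy]
    · have : f y = 0 := by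
        by_contra h
        exact hy (hsupp (mem_support.2 h))
      rw [indicator_of_notMem hy, this, enorm_zero, zero_mul]
  rw [hT]
  have h := ENNReal.lintegral_mul_le_Lp_mul_Lq (volume.restrict (ball x R')) hpq hfm.restrict
    hkm.enorm.aemeasurable
  refine h.trans ?_
  gcongr ?_ * ?_
  · exact ENNReal.rpow_le_rpow (lintegral_mono' Measure.restrict_le_self le_rfl) (by positivity)
  · exact ENNReal.rpow_le_rpow (lintegral_ball_enorm_kernel_rpow_le hk hA hq haq x hR')
      (by positivity)

/-- **The potential integral converges** for `f ∈ L^p` vanishing off a ball (`aq < 3`). [folklore] -/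
theorem integrable_mul_kernel (hk : IsSingularKernel k a A B) (hA : 0 ≤ A)
    {p q : ℝ} (hpq : p.HolderConjugate q) (haq : a * q < 3)
    {f : ℝ³ → ℝ} (hf : MemLp f (ENNReal.ofReal p) volume) {c : ℝ³} {ρ : ℝ}
    (hsupp : support f ⊆ ball c ρ) (x : ℝ³) :
    Integrable (fun y => f y * k (x - y)) volume := by
  have hp : 0 < p := hpq.pos
  have hq : 0 < q := hpq.symm.pos
  have hkm : Measurable fun y => k (x - y) :=
    hk.measurable.comp (measurable_const.sub measurable_id)
  set R' : ℝ := |ρ| + dist c x + 1 with hR'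
  have hR'0 : 0 < R' := by positivity
  have hsub : ball c ρ ⊆ ball x R' := by
    intro y hy
    rw [mem_ball] at hy ⊢
    calc dist y x ≤ dist y c + dist c x := dist_triangle _ _ _
      _ < R' := by rw [hR']; linarith [le_abs_self ρ]
  refine ⟨hf.1.mul hkm.aestronglyMeasurable, ?_⟩
  rw [hasFiniteIntegral_iff_enorm]
  simp_rw [enorm_mul]
  refine (lintegral_enorm_mul_kernel_le hk hA hpq haq hf.1 hR'0 (hsupp.trans hsub)).trans_lt ?_
  refine ENNReal.mul_lt_top ?_ ?_
  · refine ENNReal.rpow_lt_top_of_nonneg (by positivity) ?_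
    have h2 := hf.2
    rw [eLpNorm_eq_lintegral_rpow_enorm_toReal (by positivity) ENNReal.ofReal_ne_top,
      ENNReal.toReal_ofReal hp.le] at h2
    exact ((ENNReal.rpow_lt_top_iff_of_pos (by positivity)).1 h2).ne
  · exact ENNReal.rpow_lt_top_of_nonneg (by positivity) ENNReal.ofReal_ne_top

/-! ### Real-valued forms with explicit constants -/

/-- `((A^q (W R^e))^{1/q} = A W^{1/q} R^{e/q}` for nonnegative reals. [folklore] -/
theorem rpow_const_mul_rpow_inv {A' W R' e q : ℝ} (hA : 0 ≤ A') (hW : 0 ≤ W) (hR : 0 ≤ R')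
    (hq : 0 < q) : (A' ^ q * (W * R' ^ e)) ^ (1 / q) = A' * W ^ (1 / q) * R' ^ (e / q) := by
  rw [Real.mul_rpow (by positivity) (by positivity), Real.mul_rpow hW (by positivity),
    ← Real.rpow_mul hA, ← Real.rpow_mul hR, mul_one_div_cancel hq.ne', Real.rpow_one,
    mul_one_div]
  ring

/-- `toReal` of `(ofReal X)^{1/q}` is `X^{1/q}` for `X ≥ 0`. [folklore] -/
theorem toReal_ofReal_rpow {X q : ℝ} (hX : 0 ≤ X) :
    ((ENNReal.ofReal X) ^ (1 / q)).toReal = X ^ (1 / q) := by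
  rw [← ENNReal.toReal_rpow, ENNReal.toReal_ofReal hX]

/-- **Hölder continuity of the potential of an `L^p` density** (the Riesz-potential estimate
behind Gilbarg–Trudinger, Lemma 7.12 / Thm. 7.17 and the `C^{0,α}`-regularity of Newtonian
potentials): for a singular kernel of degree `-a` with constants `A, B`, conjugate exponents
`p, q` with `aq < 3 < (a+1)q`, and `f ∈ L^p(ℝ³)` vanishing off a ball,
`|P f(x) - P f(z)| ≤ C ‖f‖_p |x - z|^α`, `α = 3/q - a ∈ (0, 1)`, with
`C = A (3|B₁|/(3-aq))^{1/q} (2^α + 3^α) + B (3|B₁|/((a+1)q-3))^{1/q} 2^{α-1}` and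
`‖f‖_p = (∫ |f|^p)^{1/p}`. [folklore] -/
theorem abs_potential_sub_le (hk : IsSingularKernel k a A B) (hA : 0 ≤ A) (hB : 0 ≤ B)
    {p q : ℝ} (hpq : p.HolderConjugate q) (haq : a * q < 3) (haq' : 3 < (a + 1) * q)
    {f : ℝ³ → ℝ} (hf : MemLp f (ENNReal.ofReal p) volume) {c : ℝ³} {ρ : ℝ}
    (hsupp : support f ⊆ ball c ρ) (x z : ℝ³) :
    |(∫ y, f y * k (x - y)) - ∫ y, f y * k (z - y)| ≤
      (A * (3 * (volume : Measure ℝ³).real (ball 0 1) / (3 - a * q)) ^ (1 / q) *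
          ((2 : ℝ) ^ (3 / q - a) + (3 : ℝ) ^ (3 / q - a)) +
        B * (3 * (volume : Measure ℝ³).real (ball 0 1) / ((a + 1) * q - 3)) ^ (1 / q) *
          (2 : ℝ) ^ (3 / q - a - 1)) *
      ((∫⁻ y, ‖f y‖ₑ ^ p) ^ (1 / p)).toReal * ‖x - z‖ ^ (3 / q - a) := by
  have hq : 0 < q := hpq.symm.pos
  have hp : 0 < p := hpq.pos
  set V : ℝ := 3 * (volume : Measure ℝ³).real (ball 0 1) with hV
  have hV0 : 0 ≤ V := three_mul_volume_real_ball_nonneg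
  have h3aq : 0 < 3 - a * q := by linarith
  have h3aq' : 0 < (a + 1) * q - 3 := by linarith
  set α : ℝ := 3 / q - a with hα
  by_cases hxz : x = z
  · subst hxz
    simp only [sub_self, abs_zero, norm_zero]
    by_cases hα0 : α = 0
    · rw [hα0, Real.rpow_zero]; positivity
    · rw [Real.zero_rpow hα0, mul_zero]
  have hd : 0 < ‖x - z‖ := norm_pos_iff.2 (sub_ne_zero.2 hxz)
  set d : ℝ := ‖x - z‖ with hdd
  have hfx := integrable_mul_kernel hk hA hpq haq hf hsupp x
  have hfz := integrable_mul_kernel hk hA hpq haq hf hsupp z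
  have hraw := enorm_potential_sub_le_raw hk hA hB hpq haq haq' hf.1 hxz hfx hfz
  -- finiteness of `‖f‖_p`
  set Nf : ℝ≥0∞ := (∫⁻ y, ‖f y‖ₑ ^ p) ^ (1 / p) with hNf
  have hNf_top : Nf ≠ ⊤ := by
    have h2 := hf.2
    rw [eLpNorm_eq_lintegral_rpow_enorm_toReal (by positivity) ENNReal.ofReal_ne_top,
      ENNReal.toReal_ofReal hp.le] at h2
    exact h2.ne
  -- the three terms, in real form
  have e1 : ∀ {R' : ℝ}, 0 ≤ R' →
      ((ENNReal.ofReal (A ^ q * (V * (R' ^ (3 - a * q) / (3 - a * q))))) ^ (1 / q)).toReal =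
        A * (V / (3 - a * q)) ^ (1 / q) * R' ^ α := by
    intro R' hR'
    rw [toReal_ofReal_rpow (by positivity),
      show V * (R' ^ (3 - a * q) / (3 - a * q)) = V / (3 - a * q) * R' ^ (3 - a * q) by ring,
      rpow_const_mul_rpow_inv hA (by positivity) hR' hq, hα]
    congr 1
    field_simp
  have e3 : ((ENNReal.ofReal ((B * d) ^ q * (V * ((2 * d) ^ (3 - (a + 1) * q) /
      ((a + 1) * q - 3))))) ^ (1 / q)).toReal =
        B * (V / ((a + 1) * q - 3)) ^ (1 / q) * (2 : ℝ) ^ (α - 1) * d ^ α := by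
    rw [toReal_ofReal_rpow (by positivity),
      show V * ((2 * d) ^ (3 - (a + 1) * q) / ((a + 1) * q - 3)) =
        V / ((a + 1) * q - 3) * (2 * d) ^ (3 - (a + 1) * q) by ring,
      rpow_const_mul_rpow_inv (by positivity) (by positivity) (by positivity) hq,
      show (3 - (a + 1) * q) / q = α - 1 by rw [hα]; field_simp; ring,
      Real.mul_rpow (by norm_num) hd.le]
    have hd1 : d * d ^ (α - 1) = d ^ α := by
      rw [show d ^ α = d ^ ((1 : ℝ) + (α - 1)) by ring_nf, Real.rpow_add hd, Real.rpow_one]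
    calc B * d * (V / ((a + 1) * q - 3)) ^ (1 / q) * ((2 : ℝ) ^ (α - 1) * d ^ (α - 1))
        = B * (V / ((a + 1) * q - 3)) ^ (1 / q) * (2 : ℝ) ^ (α - 1) * (d * d ^ (α - 1)) := by ring
      _ = _ := by rw [hd1]
  -- pass to real numbers
  have hfin1 : ∀ {R' : ℝ}, (ENNReal.ofReal (A ^ q * (V * (R' ^ (3 - a * q) / (3 - a * q))))) ^
      (1 / q) ≠ ⊤ := fun {R'} => ENNReal.rpow_ne_top_of_nonneg (by positivity) ENNReal.ofReal_ne_top
  have hfin3 : (ENNReal.ofReal ((B * d) ^ q * (V * ((2 * d) ^ (3 - (a + 1) * q) /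
      ((a + 1) * q - 3))))) ^ (1 / q) ≠ ⊤ :=
    ENNReal.rpow_ne_top_of_nonneg (by positivity) ENNReal.ofReal_ne_top
  have hrhs_top : Nf * ((ENNReal.ofReal (A ^ q * (V * ((2 * d) ^ (3 - a * q) / (3 - a * q))))) ^
      (1 / q) + (ENNReal.ofReal (A ^ q * (V * ((3 * d) ^ (3 - a * q) / (3 - a * q))))) ^ (1 / q) +
      (ENNReal.ofReal ((B * d) ^ q * (V * ((2 * d) ^ (3 - (a + 1) * q) /
        ((a + 1) * q - 3))))) ^ (1 / q)) ≠ ⊤ :=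
    ENNReal.mul_ne_top hNf_top
      (ENNReal.add_ne_top.2 ⟨ENNReal.add_ne_top.2 ⟨hfin1, hfin1⟩, hfin3⟩)
  have key := (ENNReal.toReal_le_toReal enorm_ne_top hrhs_top).2 hraw
  rw [toReal_enorm, Real.norm_eq_abs, ENNReal.toReal_mul,
    ENNReal.toReal_add (ENNReal.add_ne_top.2 ⟨hfin1, hfin1⟩) hfin3,
    ENNReal.toReal_add hfin1 hfin1, e1 (by positivity : (0 : ℝ) ≤ 2 * d),
    e1 (by positivity : (0 : ℝ) ≤ 3 * d), e3, Real.mul_rpow (by norm_num) hd.le,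
    Real.mul_rpow (by norm_num) hd.le] at key
  refine key.trans (le_of_eq ?_)
  ring

/-- **Boundedness of the potential of an `L^p` density**: if `f ∈ L^p` vanishes off
`B(c, ρ)` then for `x ∈ B̄(c, ρ)`,
`|P f(x)| ≤ A (3|B₁|/(3-aq))^{1/q} (2ρ)^{3/q-a} ‖f‖_p`. [folklore] -/
theorem abs_potential_le (hk : IsSingularKernel k a A B) (hA : 0 ≤ A)
    {p q : ℝ} (hpq : p.HolderConjugate q) (haq : a * q < 3)
    {f : ℝ³ → ℝ} (hf : MemLp f (ENNReal.ofReal p) volume) {c : ℝ³} {ρ : ℝ} (hρ : 0 < ρ)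
    (hsupp : support f ⊆ ball c ρ) {x : ℝ³} (hx : x ∈ closedBall c ρ) :
    |∫ y, f y * k (x - y)| ≤
      A * (3 * (volume : Measure ℝ³).real (ball 0 1) / (3 - a * q)) ^ (1 / q) *
        (2 * ρ) ^ (3 / q - a) * ((∫⁻ y, ‖f y‖ₑ ^ p) ^ (1 / p)).toReal := by
  have hq : 0 < q := hpq.symm.pos
  have hp : 0 < p := hpq.pos
  set V : ℝ := 3 * (volume : Measure ℝ³).real (ball 0 1) with hV
  have h3aq : 0 < 3 - a * q := by linarith
  have hsub : ball c ρ ⊆ ball x (2 * ρ) := by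
    intro y hy
    rw [mem_ball] at hy ⊢
    rw [mem_closedBall] at hx
    calc dist y x ≤ dist y c + dist c x := dist_triangle _ _ _
      _ < 2 * ρ := by rw [dist_comm c x]; linarith
  have h1 : ‖∫ y, f y * k (x - y)‖ₑ ≤ (∫⁻ y, ‖f y‖ₑ ^ p) ^ (1 / p) *
      (ENNReal.ofReal (A ^ q * (V * ((2 * ρ) ^ (3 - a * q) / (3 - a * q))))) ^ (1 / q) := by
    refine (enorm_integral_le_lintegral_enorm _).trans ?_
    simp_rw [enorm_mul]
    exact lintegral_enorm_mul_kernel_le hk hA hpq haq hf.1 (by positivity) (hsupp.trans hsub)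
  have hNf_top : (∫⁻ y, ‖f y‖ₑ ^ p) ^ (1 / p) ≠ ⊤ := by
    have h2 := hf.2
    rw [eLpNorm_eq_lintegral_rpow_enorm_toReal (by positivity) ENNReal.ofReal_ne_top,
      ENNReal.toReal_ofReal hp.le] at h2
    exact h2.ne
  have hfin : (ENNReal.ofReal (A ^ q * (V * ((2 * ρ) ^ (3 - a * q) / (3 - a * q))))) ^ (1 / q)
      ≠ ⊤ := ENNReal.rpow_ne_top_of_nonneg (by positivity) ENNReal.ofReal_ne_top
  have key := (ENNReal.toReal_le_toReal enorm_ne_top (ENNReal.mul_ne_top hNf_top hfin)).2 h1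
  rw [toReal_enorm, Real.norm_eq_abs, ENNReal.toReal_mul, toReal_ofReal_rpow (by positivity),
    show V * ((2 * ρ) ^ (3 - a * q) / (3 - a * q)) = V / (3 - a * q) * (2 * ρ) ^ (3 - a * q)
      by ring,
    rpow_const_mul_rpow_inv hA (by positivity) (by positivity) hq,
    show (3 - a * q) / q = 3 / q - a by field_simp] at key
  refine key.trans (le_of_eq ?_)
  ring

/-! ### The Newtonian kernel and its gradient are singular kernels of degrees `-1`, `-2` -/

/-- On the segment from `x - y` to `z - y`, all points have norm at least `|x - y|/2` provided
`2|x - z| ≤ |x - y|`. [folklore] -/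
theorem half_norm_le_of_mem_segment {x z y w : ℝ³} (hy : 2 * ‖x - z‖ ≤ ‖x - y‖)
    (hw : w ∈ segment ℝ (x - y) (z - y)) : ‖x - y‖ / 2 ≤ ‖w‖ := by
  rw [segment_eq_image'] at hw
  obtain ⟨θ, hθ, rfl⟩ := hw
  have h1 : ‖θ • (z - y - (x - y))‖ ≤ ‖x - z‖ := by
    rw [show z - y - (x - y) = z - x by abel, norm_smul, Real.norm_eq_abs, abs_of_nonneg hθ.1,
      norm_sub_rev z x]
    calc θ * ‖x - z‖ ≤ 1 * ‖x - z‖ := by gcongr; exact hθ.2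
      _ = ‖x - z‖ := one_mul _
  have h2 : ‖x - y‖ - ‖θ • (z - y - (x - y))‖ ≤ ‖x - y + θ • (z - y - (x - y))‖ := by
    have := norm_sub_le (x - y + θ • (z - y - (x - y))) (θ • (z - y - (x - y)))
    rw [add_sub_cancel_right] at this
    linarith
  linarith

/-- **`Γ` is a singular kernel of degree `-1`** with `A = (4π)⁻¹`, `B = π⁻¹`:
`|Γ(z)| = (4π|z|)⁻¹` and, by the mean value inequality with `|∇Γ(w)| = (4π|w|²)⁻¹` on the
segment (where `|w| ≥ |x - y|/2`), `|Γ(x - y) - Γ(z - y)| ≤ π⁻¹ |x - z| |x - y|⁻²`. [folklore] -/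
theorem isSingularKernel_newtonKernel :
    IsSingularKernel newtonKernel 1 (4 * π)⁻¹ π⁻¹ where
  measurable := measurable_newtonKernel
  abs_le z := by
    rw [abs_newtonKernel, Real.rpow_neg_one, mul_inv]
  abs_sub_le x z y hxz hy := by
    have hd : 0 < ‖x - z‖ := norm_pos_iff.2 (sub_ne_zero.2 hxz)
    have hxy : 0 < ‖x - y‖ := by linarith
    set C : ℝ := (π * ‖x - y‖ ^ 2)⁻¹ with hC
    have hseg : ∀ w ∈ segment ℝ (x - y) (z - y), ‖x - y‖ / 2 ≤ ‖w‖ := fun w hw =>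
      half_norm_le_of_mem_segment hy hw
    have hne : ∀ w ∈ segment ℝ (x - y) (z - y), w ≠ 0 := fun w hw => by
      have := hseg w hw
      rw [← norm_pos_iff]; linarith
    have hdiff : ∀ w ∈ segment ℝ (x - y) (z - y), DifferentiableAt ℝ newtonKernel w :=
      fun w hw => (hasFDerivAt_newtonKernel (hne w hw)).differentiableAt
    have hbound : ∀ w ∈ segment ℝ (x - y) (z - y), ‖fderiv ℝ newtonKernel w‖ ≤ C := by
      intro w hw
      rw [norm_fderiv_newtonKernel (hne w hw), hC]
      have h2 := hseg w hw
      have h4 : 0 < ‖x - y‖ / 2 := by linarith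
      have hw1 : 0 < ‖w‖ := by linarith
      rw [inv_le_inv₀ (mul_pos (mul_pos four_pos Real.pi_pos) (pow_pos hw1 2))
        (mul_pos Real.pi_pos (pow_pos hxy 2))]
      nlinarith [mul_le_mul h2 h2 h4.le (norm_nonneg w), Real.pi_pos]
    have hmv := (convex_segment (x - y) (z - y)).norm_image_sub_le_of_norm_fderiv_le hdiff hbound
      (right_mem_segment ℝ (x - y) (z - y)) (left_mem_segment ℝ (x - y) (z - y))
    rw [show x - y - (z - y) = x - z by abel] at hmv
    rw [← Real.norm_eq_abs]
    refine hmv.trans (le_of_eq ?_)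
    rw [hC, show (-(1 + 1) : ℝ) = -2 by norm_num, Real.rpow_neg (norm_nonneg _),
      show (2 : ℝ) = ((2 : ℕ) : ℝ) by norm_num, Real.rpow_natCast, mul_inv]
    ring

/-- The `j`-th partial derivative of the Newtonian kernel, `∂ⱼΓ(z) = zⱼ/(4π|z|³)`, as an
everywhere-defined function (value `0` at the origin); equal to `DΓ(z) eⱼ` for `z ≠ 0`
(`fderiv_newtonKernel_apply`). [folklore] -/
def newtonKernelGrad (j : Fin 3) (z : ℝ³) : ℝ := ⟪z, 𝐞 j⟫ / (4 * π * ‖z‖ ^ 3)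

/-- `∂ⱼΓ(z) = DΓ(z) eⱼ` off the origin. [folklore] -/
theorem newtonKernelGrad_eq_fderiv {j : Fin 3} {z : ℝ³} (hz : z ≠ 0) :
    newtonKernelGrad j z = fderiv ℝ newtonKernel z (𝐞 j) := by
  rw [newtonKernelGrad, fderiv_newtonKernel_apply hz]

/-- `∂ⱼΓ` is measurable. [folklore] -/
theorem measurable_newtonKernelGrad (j : Fin 3) : Measurable (newtonKernelGrad j) := by
  unfold newtonKernelGrad
  exact (continuous_id.inner continuous_const).measurable.div
    ((continuous_const.mul (continuous_norm.pow 3)).measurable)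

/-- **`∂ⱼΓ` is a singular kernel of degree `-2`** with `A = (4π)⁻¹`, `B = 8/π`:
`|∂ⱼΓ(z)| ≤ (4π|z|²)⁻¹` and, by the mean value inequality with `|D²Γ(w)| ≤ (π|w|³)⁻¹` on the
segment, `|∂ⱼΓ(x - y) - ∂ⱼΓ(z - y)| ≤ (8/π) |x - z| |x - y|⁻³`. [folklore] -/
theorem isSingularKernel_newtonKernelGrad (j : Fin 3) :
    IsSingularKernel (newtonKernelGrad j) 2 (4 * π)⁻¹ (8 / π) where
  measurable := measurable_newtonKernelGrad j
  abs_le z := by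
    by_cases hz : z = 0
    · subst hz
      simp [newtonKernelGrad, Real.zero_rpow (by norm_num : (-2 : ℝ) ≠ 0)]
    have hz' : 0 < ‖z‖ := norm_pos_iff.2 hz
    rw [newtonKernelGrad, abs_div, abs_of_pos (by positivity : (0 : ℝ) < 4 * π * ‖z‖ ^ 3),
      Real.rpow_neg (norm_nonneg _), show (2 : ℝ) = ((2 : ℕ) : ℝ) by norm_num, Real.rpow_natCast,
      div_le_iff₀ (by positivity)]
    calc |⟪z, 𝐞 j⟫| ≤ ‖z‖ * ‖(𝐞 j : ℝ³)‖ := abs_real_inner_le_norm _ _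
      _ = ‖z‖ := by simp
      _ = (4 * π)⁻¹ * (‖z‖ ^ 2)⁻¹ * (4 * π * ‖z‖ ^ 3) := by field_simp
  abs_sub_le x z y hxz hy := by
    have hd : 0 < ‖x - z‖ := norm_pos_iff.2 (sub_ne_zero.2 hxz)
    have hxy : 0 < ‖x - y‖ := by linarith
    set F : ℝ³ → ℝ := fun w => fderiv ℝ newtonKernel w (𝐞 j) with hF
    set C : ℝ := 8 / (π * ‖x - y‖ ^ 3) with hC
    have hseg : ∀ w ∈ segment ℝ (x - y) (z - y), ‖x - y‖ / 2 ≤ ‖w‖ := fun w hw =>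
      half_norm_le_of_mem_segment hy hw
    have hne : ∀ w ∈ segment ℝ (x - y) (z - y), w ≠ 0 := fun w hw => by
      have := hseg w hw
      rw [← norm_pos_iff]; linarith
    have hdiff : ∀ w ∈ segment ℝ (x - y) (z - y), DifferentiableAt ℝ F w := by
      intro w hw
      have h1 : ContDiffAt ℝ 1 (fderiv ℝ newtonKernel) w :=
        (contDiffAt_newtonKernel (hne w hw) (n := 2)).fderiv_right le_rfl
      exact (h1.differentiableAt one_ne_zero).clm_apply (differentiableAt_const _)
    have hbound : ∀ w ∈ segment ℝ (x - y) (z - y), ‖fderiv ℝ F w‖ ≤ C := by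
      intro w hw
      have hw0 := hne w hw
      have hw1 : 0 < ‖w‖ := norm_pos_iff.2 hw0
      have h2 := hseg w hw
      refine ContinuousLinearMap.opNorm_le_bound _ (by positivity) fun b => ?_
      rw [Real.norm_eq_abs, hF]
      refine (abs_fderiv_fderiv_newtonKernel_apply_le hw0 (𝐞 j) b).trans ?_
      have he : ‖(𝐞 j : ℝ³)‖ = 1 := by simp
      rw [he, one_mul, div_eq_mul_inv, mul_comm]
      refine mul_le_mul_of_nonneg_right ?_ (norm_nonneg b)
      rw [hC, inv_eq_one_div, div_le_div_iff₀ (by positivity) (by positivity), one_mul]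
      have h4 : 0 < ‖x - y‖ / 2 := by linarith
      have h5 : (‖x - y‖ / 2) ^ 3 ≤ ‖w‖ ^ 3 := pow_le_pow_left₀ h4.le h2 3
      nlinarith [Real.pi_pos]
    have hmv := (convex_segment (x - y) (z - y)).norm_image_sub_le_of_norm_fderiv_le hdiff hbound
      (right_mem_segment ℝ (x - y) (z - y)) (left_mem_segment ℝ (x - y) (z - y))
    rw [show x - y - (z - y) = x - z by abel] at hmv
    have hxy0 : x - y ≠ 0 := hne _ (left_mem_segment ℝ (x - y) (z - y))
    have hzy0 : z - y ≠ 0 := hne _ (right_mem_segment ℝ (x - y) (z - y))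
    rw [newtonKernelGrad_eq_fderiv hxy0, newtonKernelGrad_eq_fderiv hzy0, ← Real.norm_eq_abs]
    refine hmv.trans (le_of_eq ?_)
    rw [hC, show (-(2 + 1) : ℝ) = -3 by norm_num, Real.rpow_neg (norm_nonneg _),
      show (3 : ℝ) = ((3 : ℕ) : ℝ) by norm_num, Real.rpow_natCast]
    field_simp

end NewtonPotentialHolder

end Literature.Analysis.FluidPDE
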